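import Literature.Probability.Percolation.AdjSlotDefs
import Literature.Probability.Percolation.ArmSeparationOutRouteFour
import HarnessLib

/-!
# The routing predicate of a slot of the adjacent outer landing, and the slot of good tip data

Topic `Literature/Probability/Percolation`; family `crit-perc` / near-critical percolation on `𝕋`.
A brick of the near-critical arm-separation theorem for four arms in the ADJACENT colour
arrangement (P. Nolin, EJP 13 (2008), Thm. 11, `j = 4`, `σ = BBWW` [arXiv 0711.4948: Thm. 10],
landing step, §4.4 p. 12 with Prop. 12 (i) and Lemma 13); the adjacent twin of `Slot4.RouteOK`
(`ArmSeparationOutSlotsFour.lean`) and of `exists_routeOK` (`ArmSeparationOutRouteFour.lean`).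

* `ASlot.RouteOK P σ` — everything the landing needs besides the realised exits: ranges; distinct
  levels; arcs inside their rings; the entry piece of the exit's own spoke and its exit run on its arc,
  read in the exit's READING ring (`δ = ts a` more rotations than `ρ^r`); the arc of `a` off the
  spoke windows of the exits of higher level and off the approach windows of those of lower level
  (all pairs); targets off the danger zones; on a common actual side the exterior footprint rows of
  one exit off the spoke rows of another;
* `AdjTipData.slotOf D tc R` — the slot of good tip data with targets and a routing certificate, and
  **`routeOK_slotOf`** — it satisfies the routing predicate (from `AdjRoute.lean`: `hull_facts`,
  `excl`, and the row gaps of `AdjTipData.Good`).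

Everything here is proved; no named facts are introduced.

## References

* P. Nolin, Near-critical percolation in two dimensions, *Electron. J. Probab.* 13 (2008), §4.3
  Prop. 12 (i), Lemma 13, §4.4 (arXiv 0711.4948: Prop. 11, Lemma 12; proof of Thm. 10, p. 12) [Nolin2008].
-/

noncomputable section

namespace Literature.Probability.Percolation

open Lanes AdjTipData

namespace ASlot

variable (P : OParams) (σ : ASlot)

/-- lateral index of the entry piece of the exit `a` on its ring [folklore] -/
def ιE (a : Fin 4) : ℕ := latIdx P.sA (σ.rE P a) (σ.ξ P a)
/-- lateral index of the first piece of the exit run of `a` (target row) [folklore] -/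
def x (a : Fin 4) : ℕ := latIdx P.sA (σ.rE P a) (σ.tr P a)
/-- the spoke of the exit `b` as an object of the reading ring of the exit `a` [folklore] -/
def XO (a b : Fin 4) : RingObj := ⟨sft (ts a) (σ.i' b), σ.ξ P b - P.sA, σ.ξ P b⟩
/-- the target of the exit `b` (approach rows) as an object of the reading ring of the exit `a` [folklore] -/
def YO (a b : Fin 4) : RingObj := ⟨sft (ts a) (ts b), σ.tr P b - P.sA, σ.tr P b + ((P.dA - 1 : ℕ) : ℤ) * P.sA⟩

/-- **The routing predicate of a slot.** [cite: Nolin2008, §4.3 Lemma 13 and §4.4 (arXiv 0711.4948: Lemma 12; proof of Thm. 10, p. 12)] -/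
structure RouteOK : Prop where
  /-- sides -/
  hi : ∀ a, σ.i a < 6
  /-- scale indices -/
  hj : ∀ a, σ.j a < P.K
  /-- windows -/
  hν : ∀ a, σ.ν a < P.NwA
  /-- rotation -/
  hr : σ.r < 6
  /-- target candidates -/
  htc : ∀ s, σ.tc s < 5
  /-- levels -/
  hlv : ∀ a, σ.lv a < 8
  /-- distinct levels -/
  hlv_ne : ∀ a b, a ≠ b → σ.lv a ≠ σ.lv b
  /-- the windows hold middle rows: spoke rows in `[-2M + 2sA, -2ε - 4sA)` -/
  hξ : ∀ a, -(2 * (P.M : ℤ)) + 2 * P.sA ≤ σ.ξ P a ∧ σ.ξ P a + 2 * P.ε + 4 * P.sA < 0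
  /-- the windows hold middle tips: `-2M + R₀ ≤ T + w + 3k`, `T ≤ -R₀` -/
  hT : ∀ a, -(2 * (P.M : ℤ)) + P.R₀ ≤ σ.T P a + P.w + 3 * σ.k P a ∧ σ.T P a ≤ -(P.R₀ : ℤ)
  /-- arcs inside their rings -/
  harc : ∀ a, σ.ast a < σ.GE P a ∧ 1 ≤ σ.aln a ∧ σ.aln a ≤ σ.GE P a
  /-- the entry piece of the own spoke on the arc (reading ring) -/
  hentry : ∀ a, InArc (σ.GE P a) (σ.ast a) (σ.aln a) (extPos (σ.nE P a) (sft (ts a) (σ.i' a)) (σ.ιE P a))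
  /-- the exit run on the arc (reading ring, side `0`) -/
  hrun : ∀ a p, 2 * σ.x P a ≤ p → p ≤ 2 * (σ.x P a + P.dA) → InArc (σ.GE P a) (σ.ast a) (σ.aln a) p
  /-- the arc off the spoke windows of higher exits -/
  hexclX : ∀ a b, a ≠ b → σ.lv a < σ.lv b → ∀ p, (σ.XO P a b).rwlo (σ.nE P a) P.sA (σ.rE P a) ≤ p →
    p ≤ (σ.XO P a b).rwhi (σ.nE P a) P.sA (σ.rE P a) → ¬ InArc (σ.GE P a) (σ.ast a) (σ.aln a) p
  /-- the arc off the approach windows of lower exits -/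
  hexclY : ∀ a b, a ≠ b → σ.lv b < σ.lv a → ∀ p, (σ.YO P a b).rwlo (σ.nE P a) P.sA (σ.rE P a) ≤ p →
    p ≤ (σ.YO P a b).rwhi (σ.nE P a) P.sA (σ.rE P a) → ¬ InArc (σ.GE P a) (σ.ast a) (σ.aln a) p
  /-- targets off the danger zones -/
  htgt : ∀ a e, σ.i' a = ts e → σ.ξ P a + P.μ + 8 * P.sA < σ.tr P e ∨ σ.tr P e + (P.N' / 64 : ℕ) + P.μ + 8 * P.sA < σ.ξ P a
  /-- exterior footprints off the spokes on a common side -/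
  hrows : ∀ a b, a ≠ b → σ.i a = σ.i b → σ.T P a + P.w + 3 * σ.k P a < σ.ξ P b ∨ σ.ξ P b + 2 * P.ε < σ.T P a
  /-- spokes on a common side have disjoint rows -/
  hspk : ∀ a b, a ≠ b → σ.i a = σ.i b → σ.ξ P a + 2 * P.ε < σ.ξ P b ∨ σ.ξ P b + 2 * P.ε < σ.ξ P a

end ASlot

/-! ### The slot of good tip data -/

namespace AdjTipData

variable (P : OParams) (D : AdjTipData) (tc : ℕ → ℕ) (R : Route)

/-- **The slot of good tip data** with targets `tc` and a routing certificate `R`: sides, scale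
indices, windows from the data; levels from the lanes; the arc of `a` is its hull read in its reading
ring (`δ = ts a`). [folklore] -/
def slotOf : ASlot :=
  ⟨fun q a => (![D.i a, D.j a, D.ν a, lv P D tc R a, astAbs P D tc R (ts a) a, alnE P D tc R (ts a) a,
    (![R.r, tc 4, tc 5, 0] : Fin 4 → ℕ) a, tc a] : Fin 8 → ℕ) q⟩

variable {P D tc R}

/-- The sides of the slot. [folklore] -/
@[simp] theorem slotOf_i (a : Fin 4) : (slotOf P D tc R).i a = D.i a := rfl
/-- The scale indices of the slot. [folklore] -/
@[simp] theorem slotOf_j (a : Fin 4) : (slotOf P D tc R).j a = D.j a := rfl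
/-- The windows of the slot. [folklore] -/
@[simp] theorem slotOf_ν (a : Fin 4) : (slotOf P D tc R).ν a = D.ν a := rfl
/-- The levels of the slot. [folklore] -/
@[simp] theorem slotOf_lv (a : Fin 4) : (slotOf P D tc R).lv a = lv P D tc R a := rfl
/-- The arc starts of the slot. [folklore] -/
@[simp] theorem slotOf_ast (a : Fin 4) : (slotOf P D tc R).ast a = astAbs P D tc R (ts a) a := rfl
/-- The arc lengths of the slot. [folklore] -/
@[simp] theorem slotOf_aln (a : Fin 4) : (slotOf P D tc R).aln a = alnE P D tc R (ts a) a := rfl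
/-- The rotation of the slot. [folklore] -/
@[simp] theorem slotOf_r : (slotOf P D tc R).r = R.r := rfl
/-- The target candidates of the slot. [folklore] -/
theorem slotOf_tc {s : ℕ} (hs : s < 6) : (slotOf P D tc R).tc s = tc s := by
  unfold ASlot.tc slotOf
  by_cases h4 : s < 4
  · rw [dif_pos h4]
    -- row `7`, entry `s`
    show (![D.i ⟨s, h4⟩, D.j ⟨s, h4⟩, D.ν ⟨s, h4⟩, lv P D tc R ⟨s, h4⟩, astAbs P D tc R (ts ⟨s, h4⟩) ⟨s, h4⟩,
      alnE P D tc R (ts ⟨s, h4⟩) ⟨s, h4⟩, (![R.r, tc 4, tc 5, 0] : Fin 4 → ℕ) ⟨s, h4⟩, tc (⟨s, h4⟩ : Fin 4)] : Fin 8 → ℕ) 7 = tc s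
    rfl
  · rw [dif_neg h4, dif_pos hs]
    have hs' : s = 4 ∨ s = 5 := by omega
    rcases hs' with rfl | rfl
    · rfl
    · rfl
/-- The scales of the slot. [folklore] -/
@[simp] theorem slotOf_k (a : Fin 4) : (slotOf P D tc R).k P a = D.k P a := rfl
/-- The window starts of the slot. [folklore] -/
@[simp] theorem slotOf_T (a : Fin 4) : (slotOf P D tc R).T P a = D.T P a := rfl
/-- The spoke rows of the slot. [folklore] -/
@[simp] theorem slotOf_ξ (a : Fin 4) : (slotOf P D tc R).ξ P a = D.ξ P a := rfl
/-- The ring radii of the slot. [folklore] -/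
@[simp] theorem slotOf_rE (a : Fin 4) : (slotOf P D tc R).rE P a = rE P D tc R a := rfl
/-- The ring chunks of the slot. [folklore] -/
@[simp] theorem slotOf_nE (a : Fin 4) : (slotOf P D tc R).nE P a = nE P D tc R a := rfl
/-- The ring tubes of the slot. [folklore] -/
@[simp] theorem slotOf_GE (a : Fin 4) : (slotOf P D tc R).GE P a = GE P D tc R a := rfl
/-- The rotated sides of the slot. [folklore] -/
theorem slotOf_i' (hr : R.r < 6) (a : Fin 4) : (slotOf P D tc R).i' a = R.i' D a := by
  unfold ASlot.i' Route.i'; rw [slotOf_i, slotOf_r, Nat.mod_eq_of_lt hr]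
/-- The actual target sides of the slot. [folklore] -/
theorem slotOf_as (e : Fin 4) : (slotOf P D tc R).as e = R.as e := rfl
/-- The target rows of the slot. [folklore] -/
theorem slotOf_tr (e : Fin 4) : (slotOf P D tc R).tr P e = tr P tc R e := by
  unfold ASlot.tr AdjTipData.tr
  have h6 : R.as e < 6 := Nat.mod_lt _ (by norm_num)
  rw [slotOf_as, slotOf_tc h6]

/-- Lane levels are injective. [folklore] -/
theorem lv_injective {a b : Fin 4} (hab : a ≠ b) : lv P D tc R a ≠ lv P D tc R b := by
  unfold lv Lanes.laneLevel
  have : (a : ℕ) ≠ b := fun h => hab (Fin.ext h)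
  split_ifs <;> omega

/-- **Exterior footprints off the spokes on a common side**, from the row gaps of good tip data, in
every relative position of the two tips (including the glued ones). [cite: Nolin2008, §4.2 Def. 6–8 and §4.4 (arXiv 0711.4948), free spaces of consecutive arms] -/
theorem Good.rows (hV : P.ValidA) (hD : D.Good P) {a b : Fin 4} (hab : a ≠ b) (hi : D.i a = D.i b) :
    D.T P a + P.w + 3 * D.k P a < D.ξ P b ∨ D.ξ P b + 2 * P.ε < D.T P a := by
  obtain ⟨ka1, kμa, hsA, hw1, hε1, hk₀, fa1, fa2, hξa, za1, za2, -⟩ := hD.facts hV a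
  obtain ⟨kb1, kμb, -, -, -, -, fb1, fb2, hξb, zb1, zb2, -⟩ := hD.facts hV b
  have hζa := D.ζ_eq (P := P) a
  have hζb := D.ζ_eq (P := P) b
  have htne := hD.htne a b hab hi
  by_cases hcol : col a = col b
  · obtain ⟨hua, ga⟩ := hD.hsame a b hab hcol hi
    obtain ⟨hub, gb⟩ := hD.hsame b a (Ne.symm hab) (hcol ▸ rfl) hi.symm
    have ea := hζa.1 hua; have eb := hζb.1 hub
    rcases lt_or_gt_of_ne htne with hl | hl
    · have := ga hl; left; omega
    · have := gb hl; right; omega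
  · have da := hD.hdiff a b hcol hi
    have db := hD.hdiff b a (Ne.symm hcol) hi.symm
    cases hua : D.up a <;> cases hub : D.up b
    · have ea := hζa.1 hua; have eb := hζb.1 hub
      rcases lt_or_gt_of_ne htne with hl | hl
      · rcases da (Or.inl ⟨hua, hl⟩) with h | h <;> [left; right] <;> omega
      · rcases db (Or.inl ⟨hub, hl⟩) with h | h <;> [right; right] <;> omega
    · have ea := hζa.1 hua; have eb := hζb.2 hub
      rcases lt_or_gt_of_ne htne with hl | hl
      · rcases da (Or.inl ⟨hua, hl⟩) with h | h
        · rcases db (Or.inr ⟨hub, hl⟩) with h' | h' <;> [left; left] <;> omega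
        · omega
      · right; omega
    · have ea := hζa.2 hua; have eb := hζb.1 hub
      rcases lt_or_gt_of_ne htne with hl | hl
      · left; omega
      · rcases da (Or.inr ⟨hua, hl⟩) with h | h
        · omega
        · rcases db (Or.inl ⟨hub, hl⟩) with h' | h' <;> [right; right] <;> omega
    · have ea := hζa.2 hua; have eb := hζb.2 hub
      rcases lt_or_gt_of_ne htne with hl | hl
      · rcases db (Or.inr ⟨hub, hl⟩) with h | h <;> [left; left] <;> omega
      · rcases da (Or.inr ⟨hua, hl⟩) with h | h <;> [right; right] <;> omega

/-- **The slot of good tip data satisfies the routing predicate.** [cite: Nolin2008, §4.3 Prop. 12 (i), Lemma 13, §4.4 (arXiv 0711.4948: Prop. 11, Lemma 12; proof of Thm. 10, p. 12)] -/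
theorem routeOK_slotOf (hV : P.ValidA) (hD : D.Good P) (htc : ∀ s, tc s < 5) (htgt : D.TgtOK P tc) (hR : R.Good P D) :
    (slotOf P D tc R).RouteOK P := by
  have hsA16 := hV.sA_facts.2
  have hs1 : 1 ≤ P.sA := by omega
  -- hull data per exit, in its reading ring
  have hull := fun a => hull_facts (tc := tc) (δ := ts a) hV hD hR a
  have ring := fun a => ringE_facts (D := D) (tc := tc) (R := R) hV a
  refine
    { hi := hD.hi, hj := hD.hj, hν := hD.hν, hr := hR.hr, htc := ?_, hlv := fun a => laneLevel_lt _ _ _,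
      hlv_ne := fun a b hab => lv_injective hab, hξ := ?_, hT := ?_, harc := ?_, hentry := ?_, hrun := ?_, hexclX := ?_,
      hexclY := ?_, htgt := ?_, hrows := ?_, hspk := ?_ }
  · intro s
    by_cases hs : s < 6
    · rw [slotOf_tc hs]; exact htc s
    · unfold ASlot.tc; rw [dif_neg (by omega), dif_neg hs]; norm_num
  · intro a
    obtain ⟨-, -, hlo, hhi, -⟩ := hD.obj_ok hV le_rfl a
    exact ⟨hlo, hhi⟩
  · intro a
    simp only [slotOf_T, slotOf_k]
    obtain ⟨ka1, kμ, hsA, hw1, hε1, hk₀, fa1, fa2, hξa, za1, za2, g1, g2, hR₀, hR₀M⟩ := hD.facts hV a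
    have hζa := D.ζ_eq (P := P) a
    cases hua : D.up a
    · have e1 := hζa.1 hua; constructor <;> omega
    · have e1 := hζa.2 hua; constructor <;> omega
  · intro a
    obtain ⟨hpc, hse, heG, -⟩ := hull a
    obtain ⟨hn1, -, -, hG, -⟩ := ring a
    simp only [slotOf_ast, slotOf_aln, slotOf_GE]
    unfold astAbs alnE
    exact ⟨Nat.mod_lt _ (by omega), by omega, by omega⟩
  · intro a
    obtain ⟨hpc, hse, heG, wlo, whi, -⟩ := hull a
    obtain ⟨hn1, hns, hMr, hG, -, -⟩ := ring a
    simp only [slotOf_ast, slotOf_aln, slotOf_GE, slotOf_nE, slotOf_i' hR.hr]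
    have hX := X_ok (tc := tc) (R := R) (δ := ts a) hV hD a a
    have hC := C_ok (tc := tc) (R := R) (δ := ts a) hV hD a
    obtain ⟨i1, i2, i3⟩ := hX.idx hs1 hns
    have hs0 : (0 : ℤ) ≤ P.sA := by positivity
    have hξs : D.ξ P a - P.sA ≤ D.ξ P a := by linarith
    have hp := RingObj.extPos_mem_rwindow (n := nE P D tc R a) (X := X P D R (ts a) a) (ι := latIdx P.sA (rE P D tc R a) (D.ξ P a))
      ((Nat.sub_le _ _).trans (latIdx_mono hξs)) (Nat.le_succ _)
    have hw := RingObj.linPos_rwindow (n := nE P D tc R a) hX hC hs1 hns (X_cut (R := R) (δ := ts a) hV hD hR a) ⟨hp.1, by omega⟩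
    have hpG : extPos (nE P D tc R a) (sft (ts a) (R.i' D a)) (latIdx P.sA (rE P D tc R a) (D.ξ P a)) < GE P D tc R a := by
      rw [hG]; exact extPos_lt hn1 (sft_lt _ _) (Nat.lt_of_le_of_lt (Nat.le_add_right _ 4) i3)
    unfold astAbs alnE ASlot.ιE
    rw [slotOf_rE, slotOf_ξ, inArc_hull_iff hpc hpG hse heG]
    unfold lp at wlo whi
    rw [hG] at wlo whi ⊢
    unfold nE at hw
    exact ⟨wlo.trans hw.1, hw.2.trans whi⟩
  · intro a p hp1 hp2
    obtain ⟨hpc, hse, heG, -, -, wlo, whi⟩ := hull a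
    obtain ⟨hn1, hns, hMr, hG, -, -⟩ := ring a
    simp only [slotOf_ast, slotOf_aln, slotOf_GE]
    have hY := Y_ok (D := D) (R := R) (δ := ts a) hV htc a a
    have hC := C_ok (tc := tc) (R := R) (δ := ts a) hV hD a
    obtain ⟨i1, i2, i3⟩ := hY.idx hs1 hns
    have hfr : (Y P tc R (ts a) a).fr = 0 := by show sft (ts a) (ts a) = 0; unfold sft; have := ts_lt a; omega
    have hxe : (slotOf P D tc R).x P a = latIdx P.sA (rE P D tc R a) (tr P tc R a) := by unfold ASlot.x; rw [slotOf_rE, slotOf_tr]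
    rw [hxe] at hp1 hp2
    -- the run positions lie in the window of the target object (side `0`: `extPos n 0 ι = 2ι`)
    have hlohi : (Y P tc R (ts a) a).rwlo (nE P D tc R a) P.sA (rE P D tc R a) ≤ p ∧ p ≤ (Y P tc R (ts a) a).rwhi (nE P D tc R a) P.sA (rE P D tc R a) := by
      have hd := hV.dA_facts
      have hhi : latIdx P.sA (rE P D tc R a) (tr P tc R a) + (P.dA - 1) ≤ latIdx P.sA (rE P D tc R a) (Y P tc R (ts a) a).hi := by
        -- `hi = tr + (dA-1) sA` has lateral index `x + (dA - 1)`
        show _ ≤ latIdx P.sA (rE P D tc R a) (tr P tc R a + ((P.dA - 1 : ℕ) : ℤ) * P.sA)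
        have hx := latIdx_spec (s := P.sA) (r := rE P D tc R a) hs1 (ξ := tr P tc R a)
          (by obtain ⟨-, -, -, -, t1, -⟩ := tgt_facts (R := R) hV htc a; have : (0:ℤ) ≤ P.sA := by positivity
              have : (2 * P.M : ℤ) ≤ rE P D tc R a := by exact_mod_cast hMr
              linarith)
        have hx' := latIdx_spec (s := P.sA) (r := rE P D tc R a) hs1 (ξ := tr P tc R a + ((P.dA - 1 : ℕ) : ℤ) * P.sA)
          (by obtain ⟨-, -, -, -, t1, -⟩ := tgt_facts (R := R) hV htc a; have : (0:ℤ) ≤ P.sA := by positivity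
              have : (2 * P.M : ℤ) ≤ rE P D tc R a := by exact_mod_cast hMr
              have : (0:ℤ) ≤ ((P.dA - 1 : ℕ) : ℤ) * P.sA := by positivity
              linarith)
        by_contra hlt
        push Not at hlt
        have : (latIdx P.sA (rE P D tc R a) (tr P tc R a + ((P.dA - 1 : ℕ) : ℤ) * P.sA) : ℤ) + 1 ≤ latIdx P.sA (rE P D tc R a) (tr P tc R a) + (P.dA - 1 : ℕ) := by
          exact_mod_cast hlt
        have hs0 : (0 : ℤ) < P.sA := by exact_mod_cast hs1
        nlinarith [hx.1, hx'.2]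
      unfold RingObj.rwlo RingObj.rwhi extPos
      rw [hfr]; simp only [blockOff]
      have hm := latIdx_mono (s := P.sA) (r := rE P D tc R a) (show tr P tc R a - P.sA ≤ tr P tc R a by
        have : (0 : ℤ) ≤ P.sA := by positivity
        linarith)
      constructor
      · show 0 + 2 * (latIdx P.sA (rE P D tc R a) (Y P tc R (ts a) a).lo - 1) ≤ p
        change 0 + 2 * (latIdx P.sA (rE P D tc R a) (tr P tc R a - P.sA) - 1) ≤ p; omega
      · omega
    have hw := RingObj.linPos_rwindow (n := nE P D tc R a) hY hC hs1 hns (Y_cut (R := R) (δ := ts a) hV hD hR htc htgt a) hlohi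
    have hpG : p < GE P D tc R a := by
      obtain ⟨-, -, bx, ex⟩ := RingObj.rwindow_mem_block (n := nE P D tc R a) hY hs1 hns
      rw [hG]; omega
    unfold astAbs alnE
    rw [inArc_hull_iff hpc hpG hse heG]
    unfold lp at wlo whi
    rw [hG] at wlo whi ⊢
    unfold nE at hw
    exact ⟨wlo.trans hw.1, hw.2.trans whi⟩
  · intro a b hab hl p hp1 hp2
    obtain ⟨hpc, hse, heG, -⟩ := hull a
    obtain ⟨hn1, hns, hMr, hG, -, -⟩ := ring a
    simp only [slotOf_ast, slotOf_aln, slotOf_GE, slotOf_lv] at hl ⊢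
    have hXO : (slotOf P D tc R).XO P a b = X P D R (ts a) b := by
      unfold ASlot.XO X; rw [slotOf_i' hR.hr, slotOf_ξ]
    rw [hXO, slotOf_nE, slotOf_rE] at hp1 hp2
    have hX := X_ok (tc := tc) (R := R) (δ := ts a) hV hD b a
    have hpG : p < GE P D tc R a := by
      obtain ⟨-, -, bx, ex⟩ := RingObj.rwindow_mem_block (n := nE P D tc R a) hX hs1 hns
      rw [hG]; omega
    unfold astAbs alnE
    rw [inArc_hull_iff hpc hpG hse heG]
    have hex := ((excl (δ := ts a) hV hD htc htgt hR hab).1 hl p hp1 hp2)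
    unfold lp at hex; omega
  · intro a b hab hl p hp1 hp2
    obtain ⟨hpc, hse, heG, -⟩ := hull a
    obtain ⟨hn1, hns, hMr, hG, -, -⟩ := ring a
    simp only [slotOf_ast, slotOf_aln, slotOf_GE, slotOf_lv] at hl ⊢
    have hYO : (slotOf P D tc R).YO P a b = Y P tc R (ts a) b := by
      unfold ASlot.YO Y; rw [slotOf_tr]
    rw [hYO, slotOf_nE, slotOf_rE] at hp1 hp2
    have hY := Y_ok (D := D) (R := R) (δ := ts a) hV htc b a
    have hpG : p < GE P D tc R a := by
      obtain ⟨-, -, bx, ex⟩ := RingObj.rwindow_mem_block (n := nE P D tc R a) hY hs1 hns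
      rw [hG]; omega
    unfold astAbs alnE
    rw [inArc_hull_iff hpc hpG hse heG]
    have hex := ((excl (δ := ts a) hV hD htc htgt hR hab).2 hl p hp1 hp2)
    unfold lp at hex; omega
  · intro a e hi
    rw [slotOf_i' hR.hr] at hi
    rw [slotOf_ξ, slotOf_tr]
    have hia : D.i a = R.as e := by
      unfold Route.i' at hi; unfold Route.as
      have h3 := hD.hi a; have hr := hR.hr; have := ts_lt e
      omega
    have h := htgt.out a
    have htr : tr P tc R e = P.tgtRow4 (tc (D.i a)) := by unfold AdjTipData.tr; rw [hia]
    rw [← htr] at h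
    exact h
  · intro a b hab hi
    simp only [slotOf_T, slotOf_ξ, slotOf_k, slotOf_i] at hi ⊢
    exact hD.rows hV hab hi
  · intro a b hab hi
    simp only [slotOf_ξ, slotOf_i] at hi ⊢
    have hs0 : (0 : ℤ) ≤ P.sA := by positivity
    rcases lt_or_gt_of_ne (hD.htne a b hab hi) with hl | hl
    · have := hD.gap hV hab hi hl; left; linarith
    · have := hD.gap hV (Ne.symm hab) hi.symm hl; right; linarith

end AdjTipData

end Literature.Probability.Percolation
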